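import Literature.Algebra.Polynomial.CasasAlvero.Char277Digits
import Literature.Algebra.Polynomial.CasasAlvero.Char277DigitsHigh
import Literature.Algebra.Polynomial.CasasAlvero.Degree6CandidatesPrime
import Literature.Algebra.Polynomial.CasasAlvero.Degree5
import Literature.Algebra.Polynomial.CasasAlvero.Degree6
import Literature.Algebra.Polynomial.CasasAlvero.DigitReduction
import HarnessLib

/-!
# Casas-Alvero degrees in characteristic 277: the complete classification

Over EVERY field `K` of characteristic `277`: `CA_d(K) ⟺ d = 0 ∨ d = a·277^k` with `1 ≤ a ≤ 6`.
Ingredients: the digit reduction `CA_d ⇒ d = a·p^k ∧ CA_a` (`DigitReduction.lean`, any field); the positive digits `1, 2, 3, 4`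
([GrafVonBothmerEtAl2007, Props. 2, 6]), `5` (`Degree5.lean`) and `6` (`277` is not among the `54` candidate bad primes of degree `6` of `Degree6CandidatesPrime.lean`, so `CA_6` holds in characteristic `277` —
a GOOD prime for degree `6` [CastryckLaterveerOunaies2012, Thm. 4] — and `CA_{6·p^k}` descends from the algebraic closure); and a refutation of every digit `7 ≤ a ≤ 276` over every field of characteristic `277`:
`7` by the sparse `𝔽_277`-septic of `Char277Digits.lean` (the degree-7 table of `BadDegrees.lean` stops at `61`); `42, 49, 50, 54, 70, 74, 75, 81, 87, 93, 107, 108, 110, 117, 124, 130, 134, 137, 145, 159, 167, 170, 173, 176, 177, 178, 180, 186, 189, 195, 199, 203, 215, 218, 224, 227, 232, 239, 240, 242, 246, 248, 249, 251, 254, 256, 257, 261, 262, 266, 267, 269, 276` by the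
binomial criterion (`m = 5, 19, 9, 5, 34, 30, 15, 9, 26, 27, 7, 29, 20, 8, 41, 21, 28, 20, 58, 20, 8, 28, 25, 87, 37, 9, 83, 20, 58, 36, 7, 49, 26, 79, 35, 73, 30, 99, 34, 36, 44, 106, 7, 103, 95, 90, 30, 60, 39, 51, 72, 27, 2`); and the 216 remaining digits by the sparse `𝔽_277`-examples of `Char277Digits.lean` and `Char277DigitsHigh.lean`.
-/

noncomputable section

open Polynomial

set_option maxRecDepth 8192

namespace Literature.Algebra.Polynomial.CasasAlvero

variable (K : Type*) [Field K] [CharP K 277]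


/-- `CA_{6·277^k}` over every field of characteristic `277` (`CA_6` itself — the case `k = 0` — holds because `277` is not among the
`54` candidate bad primes of degree `6` of `Degree6CandidatesPrime.lean`, `holdsInDegree_six_of_not_mem`, i.e. `277` is a GOOD prime for degree `6`
[cite: CastryckLaterveerOunaies2012, Thm. 4]). [cite: GrafVonBothmerEtAl2007, Prop. 6] -/
theorem holdsInDegree_six_mul_pow_of_char_277' (k : ℕ) : HoldsInDegree K (6 * 277 ^ k) := by
  haveI : Fact (Nat.Prime 277) := ⟨by norm_num⟩
  exact holdsInDegree_mul_prime_pow_field K 277 (holdsInDegree_six_of_not_mem (K := AlgebraicClosure K) 277 (by decide)) k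

set_option maxHeartbeats 1000000 in
/-- every digit `7 ≤ a < 277` fails: `¬ CA_a` over every field of characteristic `277` — the bad-prime computations of
[cite: CastryckLaterveerOunaies2012, Thm. 4] (degrees `≤ 7`) extended to every digit below `277` by explicit `𝔽_277`-rational examples and the binomial
criterion. [cite: GrafVonBothmerEtAl2007, Prop. 6] -/
theorem not_holdsInDegree_digit_of_char_twoHundredSeventySeven {a : ℕ} (h7 : 7 ≤ a) (hap : a < 277) : ¬ HoldsInDegree K a := by
  haveI : Fact (Nat.Prime 277) := ⟨by norm_num⟩
  interval_cases a
  · exact not_holdsInDegree_seven_of_char_277 K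
  · exact not_holdsInDegree_eight_of_char_277 K
  · exact not_holdsInDegree_nine_of_char_277 K
  · exact not_holdsInDegree_ten_of_char_277 K
  · exact not_holdsInDegree_eleven_of_char_277 K
  · exact not_holdsInDegree_twelve_of_char_277 K
  · exact not_holdsInDegree_thirteen_of_char_277 K
  · exact not_holdsInDegree_fourteen_of_char_277 K
  · exact not_holdsInDegree_fifteen_of_char_277 K
  · exact not_holdsInDegree_sixteen_of_char_277 K
  · exact not_holdsInDegree_seventeen_of_char_277 K
  · exact not_holdsInDegree_eighteen_of_char_277 K
  · exact not_holdsInDegree_nineteen_of_char_277 K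
  · exact not_holdsInDegree_twenty_of_char_277 K
  · exact not_holdsInDegree_twentyOne_of_char_277 K
  · exact not_holdsInDegree_twentyTwo_of_char_277 K
  · exact not_holdsInDegree_twentyThree_of_char_277 K
  · exact not_holdsInDegree_twentyFour_of_char_277 K
  · exact not_holdsInDegree_twentyFive_of_char_277 K
  · exact not_holdsInDegree_twentySix_of_char_277 K
  · exact not_holdsInDegree_twentySeven_of_char_277 K
  · exact not_holdsInDegree_twentyEight_of_char_277 K
  · exact not_holdsInDegree_twentyNine_of_char_277 K
  · exact not_holdsInDegree_thirty_of_char_277 K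
  · exact not_holdsInDegree_thirtyOne_of_char_277 K
  · exact not_holdsInDegree_thirtyTwo_of_char_277 K
  · exact not_holdsInDegree_thirtyThree_of_char_277 K
  · exact not_holdsInDegree_thirtyFour_of_char_277 K
  · exact not_holdsInDegree_thirtyFive_of_char_277 K
  · exact not_holdsInDegree_thirtySix_of_char_277 K
  · exact not_holdsInDegree_thirtySeven_of_char_277 K
  · exact not_holdsInDegree_thirtyEight_of_char_277 K
  · exact not_holdsInDegree_thirtyNine_of_char_277 K
  · exact not_holdsInDegree_forty_of_char_277 K
  · exact not_holdsInDegree_fortyOne_of_char_277 K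
  · exact not_holdsInDegree_of_choose_modEq_one K 277 (d := 42) (m := 5) (by norm_num) (by norm_num) (by decide)
  · exact not_holdsInDegree_fortyThree_of_char_277 K
  · exact not_holdsInDegree_fortyFour_of_char_277 K
  · exact not_holdsInDegree_fortyFive_of_char_277 K
  · exact not_holdsInDegree_fortySix_of_char_277 K
  · exact not_holdsInDegree_fortySeven_of_char_277 K
  · exact not_holdsInDegree_fortyEight_of_char_277 K
  · exact not_holdsInDegree_of_choose_modEq_one K 277 (d := 49) (m := 19) (by norm_num) (by norm_num) (by decide)
  · exact not_holdsInDegree_of_choose_modEq_one K 277 (d := 50) (m := 9) (by norm_num) (by norm_num) (by decide)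
  · exact not_holdsInDegree_fiftyOne_of_char_277 K
  · exact not_holdsInDegree_fiftyTwo_of_char_277 K
  · exact not_holdsInDegree_fiftyThree_of_char_277 K
  · exact not_holdsInDegree_of_choose_modEq_one K 277 (d := 54) (m := 5) (by norm_num) (by norm_num) (by decide)
  · exact not_holdsInDegree_fiftyFive_of_char_277 K
  · exact not_holdsInDegree_fiftySix_of_char_277 K
  · exact not_holdsInDegree_fiftySeven_of_char_277 K
  · exact not_holdsInDegree_fiftyEight_of_char_277 K
  · exact not_holdsInDegree_fiftyNine_of_char_277 K
  · exact not_holdsInDegree_sixty_of_char_277 K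
  · exact not_holdsInDegree_sixtyOne_of_char_277 K
  · exact not_holdsInDegree_sixtyTwo_of_char_277 K
  · exact not_holdsInDegree_sixtyThree_of_char_277 K
  · exact not_holdsInDegree_sixtyFour_of_char_277 K
  · exact not_holdsInDegree_sixtyFive_of_char_277 K
  · exact not_holdsInDegree_sixtySix_of_char_277 K
  · exact not_holdsInDegree_sixtySeven_of_char_277 K
  · exact not_holdsInDegree_sixtyEight_of_char_277 K
  · exact not_holdsInDegree_sixtyNine_of_char_277 K
  · exact not_holdsInDegree_of_choose_modEq_one K 277 (d := 70) (m := 34) (by norm_num) (by norm_num) (by decide)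
  · exact not_holdsInDegree_seventyOne_of_char_277 K
  · exact not_holdsInDegree_seventyTwo_of_char_277 K
  · exact not_holdsInDegree_seventyThree_of_char_277 K
  · exact not_holdsInDegree_of_choose_modEq_one K 277 (d := 74) (m := 30) (by norm_num) (by norm_num) (by decide)
  · exact not_holdsInDegree_of_choose_modEq_one K 277 (d := 75) (m := 15) (by norm_num) (by norm_num) (by decide)
  · exact not_holdsInDegree_seventySix_of_char_277 K
  · exact not_holdsInDegree_seventySeven_of_char_277 K
  · exact not_holdsInDegree_seventyEight_of_char_277 K
  · exact not_holdsInDegree_seventyNine_of_char_277 K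
  · exact not_holdsInDegree_eighty_of_char_277 K
  · exact not_holdsInDegree_of_choose_modEq_one K 277 (d := 81) (m := 9) (by norm_num) (by norm_num) (by decide)
  · exact not_holdsInDegree_eightyTwo_of_char_277 K
  · exact not_holdsInDegree_eightyThree_of_char_277 K
  · exact not_holdsInDegree_eightyFour_of_char_277 K
  · exact not_holdsInDegree_eightyFive_of_char_277 K
  · exact not_holdsInDegree_eightySix_of_char_277 K
  · exact not_holdsInDegree_of_choose_modEq_one K 277 (d := 87) (m := 26) (by norm_num) (by norm_num) (by decide)
  · exact not_holdsInDegree_eightyEight_of_char_277 K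
  · exact not_holdsInDegree_eightyNine_of_char_277 K
  · exact not_holdsInDegree_ninety_of_char_277 K
  · exact not_holdsInDegree_ninetyOne_of_char_277 K
  · exact not_holdsInDegree_ninetyTwo_of_char_277 K
  · exact not_holdsInDegree_of_choose_modEq_one K 277 (d := 93) (m := 27) (by norm_num) (by norm_num) (by decide)
  · exact not_holdsInDegree_ninetyFour_of_char_277 K
  · exact not_holdsInDegree_ninetyFive_of_char_277 K
  · exact not_holdsInDegree_ninetySix_of_char_277 K
  · exact not_holdsInDegree_ninetySeven_of_char_277 K
  · exact not_holdsInDegree_ninetyEight_of_char_277 K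
  · exact not_holdsInDegree_ninetyNine_of_char_277 K
  · exact not_holdsInDegree_oneHundred_of_char_277 K
  · exact not_holdsInDegree_oneHundredOne_of_char_277 K
  · exact not_holdsInDegree_oneHundredTwo_of_char_277 K
  · exact not_holdsInDegree_oneHundredThree_of_char_277 K
  · exact not_holdsInDegree_oneHundredFour_of_char_277 K
  · exact not_holdsInDegree_oneHundredFive_of_char_277 K
  · exact not_holdsInDegree_oneHundredSix_of_char_277 K
  · exact not_holdsInDegree_of_choose_modEq_one K 277 (d := 107) (m := 7) (by norm_num) (by norm_num) (by decide)
  · exact not_holdsInDegree_of_choose_modEq_one K 277 (d := 108) (m := 29) (by norm_num) (by norm_num) (by decide)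
  · exact not_holdsInDegree_oneHundredNine_of_char_277 K
  · exact not_holdsInDegree_of_choose_modEq_one K 277 (d := 110) (m := 20) (by norm_num) (by norm_num) (by decide)
  · exact not_holdsInDegree_oneHundredEleven_of_char_277 K
  · exact not_holdsInDegree_oneHundredTwelve_of_char_277 K
  · exact not_holdsInDegree_oneHundredThirteen_of_char_277 K
  · exact not_holdsInDegree_oneHundredFourteen_of_char_277 K
  · exact not_holdsInDegree_oneHundredFifteen_of_char_277 K
  · exact not_holdsInDegree_oneHundredSixteen_of_char_277 K
  · exact not_holdsInDegree_of_choose_modEq_one K 277 (d := 117) (m := 8) (by norm_num) (by norm_num) (by decide)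
  · exact not_holdsInDegree_oneHundredEighteen_of_char_277 K
  · exact not_holdsInDegree_oneHundredNineteen_of_char_277 K
  · exact not_holdsInDegree_oneHundredTwenty_of_char_277 K
  · exact not_holdsInDegree_oneHundredTwentyOne_of_char_277 K
  · exact not_holdsInDegree_oneHundredTwentyTwo_of_char_277 K
  · exact not_holdsInDegree_oneHundredTwentyThree_of_char_277 K
  · exact not_holdsInDegree_of_choose_modEq_one K 277 (d := 124) (m := 41) (by norm_num) (by norm_num) (by decide)
  · exact not_holdsInDegree_oneHundredTwentyFive_of_char_277 K
  · exact not_holdsInDegree_oneHundredTwentySix_of_char_277 K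
  · exact not_holdsInDegree_oneHundredTwentySeven_of_char_277 K
  · exact not_holdsInDegree_oneHundredTwentyEight_of_char_277 K
  · exact not_holdsInDegree_oneHundredTwentyNine_of_char_277 K
  · exact not_holdsInDegree_of_choose_modEq_one K 277 (d := 130) (m := 21) (by norm_num) (by norm_num) (by decide)
  · exact not_holdsInDegree_oneHundredThirtyOne_of_char_277 K
  · exact not_holdsInDegree_oneHundredThirtyTwo_of_char_277 K
  · exact not_holdsInDegree_oneHundredThirtyThree_of_char_277 K
  · exact not_holdsInDegree_of_choose_modEq_one K 277 (d := 134) (m := 28) (by norm_num) (by norm_num) (by decide)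
  · exact not_holdsInDegree_oneHundredThirtyFive_of_char_277 K
  · exact not_holdsInDegree_oneHundredThirtySix_of_char_277 K
  · exact not_holdsInDegree_of_choose_modEq_one K 277 (d := 137) (m := 20) (by norm_num) (by norm_num) (by decide)
  · exact not_holdsInDegree_oneHundredThirtyEight_of_char_277 K
  · exact not_holdsInDegree_oneHundredThirtyNine_of_char_277 K
  · exact not_holdsInDegree_oneHundredForty_of_char_277 K
  · exact not_holdsInDegree_oneHundredFortyOne_of_char_277 K
  · exact not_holdsInDegree_oneHundredFortyTwo_of_char_277 K
  · exact not_holdsInDegree_oneHundredFortyThree_of_char_277 K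
  · exact not_holdsInDegree_oneHundredFortyFour_of_char_277 K
  · exact not_holdsInDegree_of_choose_modEq_one K 277 (d := 145) (m := 58) (by norm_num) (by norm_num) (by decide)
  · exact not_holdsInDegree_oneHundredFortySix_of_char_277 K
  · exact not_holdsInDegree_oneHundredFortySeven_of_char_277 K
  · exact not_holdsInDegree_oneHundredFortyEight_of_char_277 K
  · exact not_holdsInDegree_oneHundredFortyNine_of_char_277 K
  · exact not_holdsInDegree_oneHundredFifty_of_char_277 K
  · exact not_holdsInDegree_oneHundredFiftyOne_of_char_277 K
  · exact not_holdsInDegree_oneHundredFiftyTwo_of_char_277 K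
  · exact not_holdsInDegree_oneHundredFiftyThree_of_char_277 K
  · exact not_holdsInDegree_oneHundredFiftyFour_of_char_277 K
  · exact not_holdsInDegree_oneHundredFiftyFive_of_char_277 K
  · exact not_holdsInDegree_oneHundredFiftySix_of_char_277 K
  · exact not_holdsInDegree_oneHundredFiftySeven_of_char_277 K
  · exact not_holdsInDegree_oneHundredFiftyEight_of_char_277 K
  · exact not_holdsInDegree_of_choose_modEq_one K 277 (d := 159) (m := 20) (by norm_num) (by norm_num) (by decide)
  · exact not_holdsInDegree_oneHundredSixty_of_char_277 K
  · exact not_holdsInDegree_oneHundredSixtyOne_of_char_277 K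
  · exact not_holdsInDegree_oneHundredSixtyTwo_of_char_277 K
  · exact not_holdsInDegree_oneHundredSixtyThree_of_char_277 K
  · exact not_holdsInDegree_oneHundredSixtyFour_of_char_277 K
  · exact not_holdsInDegree_oneHundredSixtyFive_of_char_277 K
  · exact not_holdsInDegree_oneHundredSixtySix_of_char_277 K
  · exact not_holdsInDegree_of_choose_modEq_one K 277 (d := 167) (m := 8) (by norm_num) (by norm_num) (by decide)
  · exact not_holdsInDegree_oneHundredSixtyEight_of_char_277 K
  · exact not_holdsInDegree_oneHundredSixtyNine_of_char_277 K
  · exact not_holdsInDegree_of_choose_modEq_one K 277 (d := 170) (m := 28) (by norm_num) (by norm_num) (by decide)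
  · exact not_holdsInDegree_oneHundredSeventyOne_of_char_277 K
  · exact not_holdsInDegree_oneHundredSeventyTwo_of_char_277 K
  · exact not_holdsInDegree_of_choose_modEq_one K 277 (d := 173) (m := 25) (by norm_num) (by norm_num) (by decide)
  · exact not_holdsInDegree_oneHundredSeventyFour_of_char_277 K
  · exact not_holdsInDegree_oneHundredSeventyFive_of_char_277 K
  · exact not_holdsInDegree_of_choose_modEq_one K 277 (d := 176) (m := 87) (by norm_num) (by norm_num) (by decide)
  · exact not_holdsInDegree_of_choose_modEq_one K 277 (d := 177) (m := 37) (by norm_num) (by norm_num) (by decide)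
  · exact not_holdsInDegree_of_choose_modEq_one K 277 (d := 178) (m := 9) (by norm_num) (by norm_num) (by decide)
  · exact not_holdsInDegree_oneHundredSeventyNine_of_char_277 K
  · exact not_holdsInDegree_of_choose_modEq_one K 277 (d := 180) (m := 83) (by norm_num) (by norm_num) (by decide)
  · exact not_holdsInDegree_oneHundredEightyOne_of_char_277 K
  · exact not_holdsInDegree_oneHundredEightyTwo_of_char_277 K
  · exact not_holdsInDegree_oneHundredEightyThree_of_char_277 K
  · exact not_holdsInDegree_oneHundredEightyFour_of_char_277 K
  · exact not_holdsInDegree_oneHundredEightyFive_of_char_277 K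
  · exact not_holdsInDegree_of_choose_modEq_one K 277 (d := 186) (m := 20) (by norm_num) (by norm_num) (by decide)
  · exact not_holdsInDegree_oneHundredEightySeven_of_char_277 K
  · exact not_holdsInDegree_oneHundredEightyEight_of_char_277 K
  · exact not_holdsInDegree_of_choose_modEq_one K 277 (d := 189) (m := 58) (by norm_num) (by norm_num) (by decide)
  · exact not_holdsInDegree_oneHundredNinety_of_char_277 K
  · exact not_holdsInDegree_oneHundredNinetyOne_of_char_277 K
  · exact not_holdsInDegree_oneHundredNinetyTwo_of_char_277 K
  · exact not_holdsInDegree_oneHundredNinetyThree_of_char_277 K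
  · exact not_holdsInDegree_oneHundredNinetyFour_of_char_277 K
  · exact not_holdsInDegree_of_choose_modEq_one K 277 (d := 195) (m := 36) (by norm_num) (by norm_num) (by decide)
  · exact not_holdsInDegree_oneHundredNinetySix_of_char_277 K
  · exact not_holdsInDegree_oneHundredNinetySeven_of_char_277 K
  · exact not_holdsInDegree_oneHundredNinetyEight_of_char_277 K
  · exact not_holdsInDegree_of_choose_modEq_one K 277 (d := 199) (m := 7) (by norm_num) (by norm_num) (by decide)
  · exact not_holdsInDegree_twoHundred_of_char_277 K
  · exact not_holdsInDegree_twoHundredOne_of_char_277 K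
  · exact not_holdsInDegree_twoHundredTwo_of_char_277 K
  · exact not_holdsInDegree_of_choose_modEq_one K 277 (d := 203) (m := 49) (by norm_num) (by norm_num) (by decide)
  · exact not_holdsInDegree_twoHundredFour_of_char_277 K
  · exact not_holdsInDegree_twoHundredFive_of_char_277 K
  · exact not_holdsInDegree_twoHundredSix_of_char_277 K
  · exact not_holdsInDegree_twoHundredSeven_of_char_277 K
  · exact not_holdsInDegree_twoHundredEight_of_char_277 K
  · exact not_holdsInDegree_twoHundredNine_of_char_277 K
  · exact not_holdsInDegree_twoHundredTen_of_char_277 K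
  · exact not_holdsInDegree_twoHundredEleven_of_char_277 K
  · exact not_holdsInDegree_twoHundredTwelve_of_char_277 K
  · exact not_holdsInDegree_twoHundredThirteen_of_char_277 K
  · exact not_holdsInDegree_twoHundredFourteen_of_char_277 K
  · exact not_holdsInDegree_of_choose_modEq_one K 277 (d := 215) (m := 26) (by norm_num) (by norm_num) (by decide)
  · exact not_holdsInDegree_twoHundredSixteen_of_char_277 K
  · exact not_holdsInDegree_twoHundredSeventeen_of_char_277 K
  · exact not_holdsInDegree_of_choose_modEq_one K 277 (d := 218) (m := 79) (by norm_num) (by norm_num) (by decide)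
  · exact not_holdsInDegree_twoHundredNineteen_of_char_277 K
  · exact not_holdsInDegree_twoHundredTwenty_of_char_277 K
  · exact not_holdsInDegree_twoHundredTwentyOne_of_char_277 K
  · exact not_holdsInDegree_twoHundredTwentyTwo_of_char_277 K
  · exact not_holdsInDegree_twoHundredTwentyThree_of_char_277 K
  · exact not_holdsInDegree_of_choose_modEq_one K 277 (d := 224) (m := 35) (by norm_num) (by norm_num) (by decide)
  · exact not_holdsInDegree_twoHundredTwentyFive_of_char_277 K
  · exact not_holdsInDegree_twoHundredTwentySix_of_char_277 K
  · exact not_holdsInDegree_of_choose_modEq_one K 277 (d := 227) (m := 73) (by norm_num) (by norm_num) (by decide)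
  · exact not_holdsInDegree_twoHundredTwentyEight_of_char_277 K
  · exact not_holdsInDegree_twoHundredTwentyNine_of_char_277 K
  · exact not_holdsInDegree_twoHundredThirty_of_char_277 K
  · exact not_holdsInDegree_twoHundredThirtyOne_of_char_277 K
  · exact not_holdsInDegree_of_choose_modEq_one K 277 (d := 232) (m := 30) (by norm_num) (by norm_num) (by decide)
  · exact not_holdsInDegree_twoHundredThirtyThree_of_char_277 K
  · exact not_holdsInDegree_twoHundredThirtyFour_of_char_277 K
  · exact not_holdsInDegree_twoHundredThirtyFive_of_char_277 K
  · exact not_holdsInDegree_twoHundredThirtySix_of_char_277 K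
  · exact not_holdsInDegree_twoHundredThirtySeven_of_char_277 K
  · exact not_holdsInDegree_twoHundredThirtyEight_of_char_277 K
  · exact not_holdsInDegree_of_choose_modEq_one K 277 (d := 239) (m := 99) (by norm_num) (by norm_num) (by decide)
  · exact not_holdsInDegree_of_choose_modEq_one K 277 (d := 240) (m := 34) (by norm_num) (by norm_num) (by decide)
  · exact not_holdsInDegree_twoHundredFortyOne_of_char_277 K
  · exact not_holdsInDegree_of_choose_modEq_one K 277 (d := 242) (m := 36) (by norm_num) (by norm_num) (by decide)
  · exact not_holdsInDegree_twoHundredFortyThree_of_char_277 K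
  · exact not_holdsInDegree_twoHundredFortyFour_of_char_277 K
  · exact not_holdsInDegree_twoHundredFortyFive_of_char_277 K
  · exact not_holdsInDegree_of_choose_modEq_one K 277 (d := 246) (m := 44) (by norm_num) (by norm_num) (by decide)
  · exact not_holdsInDegree_twoHundredFortySeven_of_char_277 K
  · exact not_holdsInDegree_of_choose_modEq_one K 277 (d := 248) (m := 106) (by norm_num) (by norm_num) (by decide)
  · exact not_holdsInDegree_of_choose_modEq_one K 277 (d := 249) (m := 7) (by norm_num) (by norm_num) (by decide)
  · exact not_holdsInDegree_twoHundredFifty_of_char_277 K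
  · exact not_holdsInDegree_of_choose_modEq_one K 277 (d := 251) (m := 103) (by norm_num) (by norm_num) (by decide)
  · exact not_holdsInDegree_twoHundredFiftyTwo_of_char_277 K
  · exact not_holdsInDegree_twoHundredFiftyThree_of_char_277 K
  · exact not_holdsInDegree_of_choose_modEq_one K 277 (d := 254) (m := 95) (by norm_num) (by norm_num) (by decide)
  · exact not_holdsInDegree_twoHundredFiftyFive_of_char_277 K
  · exact not_holdsInDegree_of_choose_modEq_one K 277 (d := 256) (m := 90) (by norm_num) (by norm_num) (by decide)
  · exact not_holdsInDegree_of_choose_modEq_one K 277 (d := 257) (m := 30) (by norm_num) (by norm_num) (by decide)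
  · exact not_holdsInDegree_twoHundredFiftyEight_of_char_277 K
  · exact not_holdsInDegree_twoHundredFiftyNine_of_char_277 K
  · exact not_holdsInDegree_twoHundredSixty_of_char_277 K
  · exact not_holdsInDegree_of_choose_modEq_one K 277 (d := 261) (m := 60) (by norm_num) (by norm_num) (by decide)
  · exact not_holdsInDegree_of_choose_modEq_one K 277 (d := 262) (m := 39) (by norm_num) (by norm_num) (by decide)
  · exact not_holdsInDegree_twoHundredSixtyThree_of_char_277 K
  · exact not_holdsInDegree_twoHundredSixtyFour_of_char_277 K
  · exact not_holdsInDegree_twoHundredSixtyFive_of_char_277 K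
  · exact not_holdsInDegree_of_choose_modEq_one K 277 (d := 266) (m := 51) (by norm_num) (by norm_num) (by decide)
  · exact not_holdsInDegree_of_choose_modEq_one K 277 (d := 267) (m := 72) (by norm_num) (by norm_num) (by decide)
  · exact not_holdsInDegree_twoHundredSixtyEight_of_char_277 K
  · exact not_holdsInDegree_of_choose_modEq_one K 277 (d := 269) (m := 27) (by norm_num) (by norm_num) (by decide)
  · exact not_holdsInDegree_twoHundredSeventy_of_char_277 K
  · exact not_holdsInDegree_twoHundredSeventyOne_of_char_277 K
  · exact not_holdsInDegree_twoHundredSeventyTwo_of_char_277 K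
  · exact not_holdsInDegree_twoHundredSeventyThree_of_char_277 K
  · exact not_holdsInDegree_twoHundredSeventyFour_of_char_277 K
  · exact not_holdsInDegree_twoHundredSeventyFive_of_char_277 K
  · exact not_holdsInDegree_of_choose_modEq_one K 277 (d := 276) (m := 2) (by norm_num) (by norm_num) (by decide)

/-- the positive digits `1 ≤ a ≤ 5`: `CA_{a·277^k}` over every field of characteristic `277`. [cite: GrafVonBothmerEtAl2007, Props. 2, 6]
[cite: CastryckLaterveerOunaies2012, Thm. 4] -/
theorem holdsInDegree_mul_twoHundredSeventySeven_pow_of_le_five {a : ℕ} (ha0 : 0 < a) (ha5 : a ≤ 5) (k : ℕ) :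
    HoldsInDegree K (a * 277 ^ k) := by
  haveI : Fact (Nat.Prime 277) := ⟨by norm_num⟩
  interval_cases a
  · simpa using holdsInDegree_prime_pow_field K 277 k
  · exact holdsInDegree_two_mul_prime_pow_field K 277 k
  · exact holdsInDegree_three_mul_prime_pow_field K 277 (by norm_num) k
  · exact holdsInDegree_mul_prime_pow_field K 277
      (holdsInDegree_of_le_four_of_charP (AlgebraicClosure K) 277 (by norm_num) le_rfl) k
  · exact holdsInDegree_five_mul_prime_pow_field K 277 (by norm_num) (by norm_num) (by norm_num) (by norm_num)
      (by norm_num) (by norm_num) (by norm_num) (by norm_num) (by norm_num) k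

/-- **characteristic 277, complete**: over every field of characteristic `277`,
`CA_d ⟺ d = 0 ∨ d = a·277^k` with `1 ≤ a ≤ 6`. [cite: GrafVonBothmerEtAl2007, Props. 2, 6, 7]
[cite: CastryckLaterveerOunaies2012, Thm. 4] -/
theorem classification_char_twoHundredSeventySeven_complete (d : ℕ) :
    HoldsInDegree K d ↔ d = 0 ∨ ∃ k a : ℕ, 0 < a ∧ a ≤ 6 ∧ d = a * 277 ^ k := by
  haveI : Fact (Nat.Prime 277) := ⟨by norm_num⟩
  constructor
  · intro h
    rcases Nat.eq_zero_or_pos d with rfl | hd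
    · exact Or.inl rfl
    obtain ⟨k, a, ha0, hap, rfl, ha⟩ := digit_of_holdsInDegree K 277 hd.ne' h
    refine Or.inr ⟨k, a, ha0, ?_, rfl⟩
    by_contra h6
    exact not_holdsInDegree_digit_of_char_twoHundredSeventySeven K (by omega) hap ha
  · rintro (rfl | ⟨k, a, ha0, ha6, rfl⟩)
    · exact holdsInDegree_zero K
    · rcases Nat.lt_or_ge a 6 with ha | ha
      · exact holdsInDegree_mul_twoHundredSeventySeven_pow_of_le_five K ha0 (by omega) k
      · obtain rfl : a = 6 := le_antisymm ha6 ha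
        exact holdsInDegree_six_mul_pow_of_char_277' K k

/-- the set of Casas-Alvero degrees `≤ 76729` in characteristic `277`, explicitly (corollary of the classification:
[cite: GrafVonBothmerEtAl2007, Prop. 6] with [cite: CastryckLaterveerOunaies2012, Thm. 4] and the digit refutations above). -/
theorem holdsInDegree_iff_mem_of_le_char_twoHundredSeventySeven_sq {d : ℕ} (hd : d ≤ 76729) :
    HoldsInDegree K d ↔ d ∈ ({0, 1, 2, 3, 4, 5, 6, 277, 554, 831, 1108, 1385, 1662, 76729} : Finset ℕ) := by
  rw [classification_char_twoHundredSeventySeven_complete]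
  constructor
  · rintro (rfl | ⟨k, a, ha0, ha6, rfl⟩)
    · decide
    · rcases k with _ | _ | _ | k
      · interval_cases a <;> decide
      · interval_cases a <;> decide
      · interval_cases a <;> simp_all
      · exfalso
        have : 277 ^ 3 ≤ a * 277 ^ (k + 1 + 1 + 1) :=
          le_trans (Nat.pow_le_pow_right (by norm_num) (by omega)) (Nat.le_mul_of_pos_left _ ha0)
        omega
  · intro h
    simp only [Finset.mem_insert, Finset.mem_singleton] at h
    rcases h with rfl | rfl | rfl | rfl | rfl | rfl | rfl | rfl | rfl | rfl | rfl | rfl | rfl | rfl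
    · exact Or.inl rfl
    · exact Or.inr ⟨0, 1, by norm_num, by norm_num, by norm_num⟩
    · exact Or.inr ⟨0, 2, by norm_num, by norm_num, by norm_num⟩
    · exact Or.inr ⟨0, 3, by norm_num, by norm_num, by norm_num⟩
    · exact Or.inr ⟨0, 4, by norm_num, by norm_num, by norm_num⟩
    · exact Or.inr ⟨0, 5, by norm_num, by norm_num, by norm_num⟩
    · exact Or.inr ⟨0, 6, by norm_num, by norm_num, by norm_num⟩
    · exact Or.inr ⟨1, 1, by norm_num, by norm_num, by norm_num⟩
    · exact Or.inr ⟨1, 2, by norm_num, by norm_num, by norm_num⟩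
    · exact Or.inr ⟨1, 3, by norm_num, by norm_num, by norm_num⟩
    · exact Or.inr ⟨1, 4, by norm_num, by norm_num, by norm_num⟩
    · exact Or.inr ⟨1, 5, by norm_num, by norm_num, by norm_num⟩
    · exact Or.inr ⟨1, 6, by norm_num, by norm_num, by norm_num⟩
    · exact Or.inr ⟨2, 1, by norm_num, by norm_num, by norm_num⟩

end Literature.Algebra.Polynomial.CasasAlvero
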